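import Summits.BirchSwinnertonDyer.BirchSwinnertonDyer.Theorems.SylvesterTwoHeegnerIndexUpperDescentSylvesterSha
import Mathlib.LinearAlgebra.Dimension.Torsion.Finite
import Mathlib.RingTheory.Finiteness.Basic
import HarnessLib

/-!
# Route `SylvesterTwoHeegnerIndex` (rung K7t), crux `HeegnerIndexUpperAtTwoHSY` (item 19229), layer 2:
# `Ш(E_p/ℚ) ↪ Ш(E_p/K′)` whenever `E_p` acquires NO NEW RANK over the quadratic field — the twin-rank
# input of the clean descent at `2` in its Mordell–Weil form

HONEST FRAMING (cell «bsd-cm», D-0074 seat `bsd-cm-k7t-c2`, item stmt-BirchSwinnertonDyer-19229; the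
crux — the Euler-system half of `BSD(E_p, 2)` on 𝒞_HSY — stays OPEN; nothing booked). Sequel of
`…UpperDescentSylvesterSha.lean` (`shaRestriction_injective_sylvester`, whose displayed input was
«every point of `E_p(K̃′)` has a positive multiple in `E_p(ℚ)`»). Here that input is derived from the
RANK statement `rank E_p(K̃′) = rank E_p(ℚ)` by rank–nullity over `ℤ` and Mordell–Weil
(`exists_nsmul_mem_baseChange_of_mordellWeilRank_eq`: a full-rank subgroup of a finitely generated
abelian group has torsion quotient), giving **`shaRestriction_injective_sylvester_of_rank`**: for every
model `W` of `E_p` (`p` odd prime) and every number field `K′` with `[K̃′ : ℚ] = 2`, if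
`rank E_p(K̃′) = rank E_p(ℚ)` then `Ш(E_p/ℚ) → Ш(E_p/K′)` is injective. In a Heegner frame of the route
`rank E_p(K′) = rank E_p(ℚ) + rank E_p^{(d_{K′})}(ℚ)` (tree: `mordellWeilRank_add_eq_of_baseChange`) and
the twin has rank `0` (`L(E_p^{(d)},1) ≠ 0`, Gross–Zagier–Kolyvagin / Burungale–Flach), so the
hypothesis holds; carrying that identity across `K′ ≃ K̃′` is the one typing step left displayed.
References: [SilvermanAEC2009] VIII.§1, Exercise 10.16, X.§4; [GrossLMS1991] §2; [Darmon2004] §3.9.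
-/

set_option autoImplicit false
set_option linter.dupNamespace false

noncomputable section

open scoped Classical Pointwise

universe u

open Literature.NumberTheory.EllipticCurves Literature.NumberTheory.EllipticCurves.HuShuYin2019
  WeierstrassCurve

namespace Summit.BirchSwinnertonDyer.BirchSwinnertonDyer.Theorems.SylvesterTwoUpper

/-! ## §1 No new rank ⇒ torsion quotient -/

/-- **No new rank ⇒ torsion quotient.** For a Weierstrass curve `W/K` and a field extension `L/K`
with `E(L)` finitely generated (Mordell–Weil), if `rank E(L) = rank E(K)` (`mordellWeilRank`, a
`finrank` over `ℤ`) then every point of `E(L)` has a positive multiple coming from `E(K)`: the image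
of `E(K)` has full rank, so `E(L)/E(K)` has `finrank 0` (rank–nullity over `ℤ`,
`Submodule.finrank_quotient_add_finrank`) and is torsion (`Module.finrank_eq_zero_iff_isTorsion`).
[cite: SilvermanAEC2009, VIII.§1 and Exercise 10.16] -/
theorem exists_nsmul_mem_baseChange_of_mordellWeilRank_eq
    {K : Type u} [Field K] (W : WeierstrassCurve K) (L : Type u) [Field L] [Algebra K L]
    [DecidableEq L] [Module.Finite ℤ (W.baseChange L).toAffine.Point]
    (hrank : (W.baseChange L).mordellWeilRank = W.mordellWeilRank)
    (Q : (W.baseChange L).toAffine.Point) :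
    ∃ n : ℕ, 0 < n ∧ ∃ R : W.toAffine.Point,
      n • Q = Affine.Point.baseChange (W' := W) K L R := by
  -- the image `N` of `E(K)` in `E(L)` as a `ℤ`-submodule
  let f : W.toAffine.Point →ₗ[ℤ] (W.baseChange L).toAffine.Point :=
    (Affine.Point.baseChange (W' := W) K L).toIntLinearMap
  have hf : Function.Injective f := Affine.Point.map_injective (W' := W) _
  let N : Submodule ℤ (W.baseChange L).toAffine.Point := LinearMap.range f
  -- ranks: `finrank N = finrank E(K) = finrank E(L)`, so the quotient has finrank `0`
  have h1 : Module.finrank ℤ N = Module.finrank ℤ W.toAffine.Point := LinearMap.finrank_range_of_inj hf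
  have e1 : Module.finrank ℤ W.toAffine.Point = Module.finrank ℤ (W.baseChange L).toAffine.Point := by
    -- (`mordellWeilRank` is elaborated against the classical `DecidableEq`; `convert` bridges the
    -- subsingleton instance gap)
    convert hrank.symm using 2 <;> (unfold WeierstrassCurve.mordellWeilRank; congr!)
  haveI hfinq : Module.Finite ℤ ((W.baseChange L).toAffine.Point ⧸ N) :=
    Module.Finite.quotient ℤ N
  have hq : Module.finrank ℤ ((W.baseChange L).toAffine.Point ⧸ N) = 0 := by
    have h := Submodule.finrank_quotient_add_finrank N
    rw [h1, e1] at h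
    exact Nat.add_right_cancel (h.trans (zero_add _).symm)
  have htors : Module.IsTorsion ℤ ((W.baseChange L).toAffine.Point ⧸ N) :=
    Module.finrank_eq_zero_iff_isTorsion.mp hq
  -- so some nonzero integer multiple of `Q` lies in `N`
  obtain ⟨a, ha⟩ := @htors (Submodule.Quotient.mk Q)
  have ha0 : (a : ℤ) ≠ 0 := nonZeroDivisors.coe_ne_zero a
  have hmem : (a : ℤ) • Q ∈ N := by
    rw [← Submodule.Quotient.mk_eq_zero, Submodule.Quotient.mk_smul]
    exact ha
  have hmem' : (a : ℤ).natAbs • Q ∈ N := by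
    rcases Int.natAbs_eq (a : ℤ) with h | h
    · rw [← natCast_zsmul, ← h]; exact hmem
    · have hneg : -((a : ℤ) • Q) ∈ N := N.neg_mem hmem
      rw [← natCast_zsmul]
      have e : ((a : ℤ).natAbs : ℤ) = -(a : ℤ) := by omega
      rw [e, neg_smul]; exact hneg
  obtain ⟨R, hR⟩ := hmem'
  exact ⟨(a : ℤ).natAbs, Int.natAbs_pos.mpr ha0, R, hR.symm⟩

/-! ## §2 The descent for `E_p` from the rank statement -/

/-- **`Ш(E_p/ℚ) → Ш(E_p/K′)` is INJECTIVE whenever `rank E_p(K̃′) = rank E_p(ℚ)`** (`p` an odd prime,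
`W` any elliptic model of `E_p` over `ℚ`, `K′` a number field with `[K̃′ : ℚ] = 2`, `K̃′ ⊆ ℚ̄` the
Galois closure). Mordell–Weil for `E_p(K̃′)` (tree theorem `addGroup_fg_point_holds`) makes §1
applicable; then `shaRestriction_injective_sylvester`. In a Heegner frame the rank hypothesis is
«the twin `E_p^{(d_{K′})}` has rank `0`» (`mordellWeilRank_add_eq_of_baseChange`), which
`L(E_p^{(d)},1) ≠ 0` supplies through Gross–Zagier–Kolyvagin / Burungale–Flach.
[cite: SilvermanAEC2009, Thm. VIII.6.7 and X.§4] [cite: GrossLMS1991, §2] -/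
theorem shaRestriction_injective_sylvester_of_rank {p : ℕ} (hp : p.Prime) (hp2 : p ≠ 2)
    (W : WeierstrassCurve ℚ) [W.IsElliptic]
    (hW : ∃ C : VariableChange ℚ, C • W = cubeSumCurve (p : ℚ))
    (K' : Type) [Field K'] [NumberField K']
    (hL : Module.finrank ℚ (galoisClosureIn (K := ℚ) K') = 2)
    (hrank : (W.baseChange (galoisClosureIn (K := ℚ) K')).mordellWeilRank = W.mordellWeilRank) :
    Function.Injective (shaRestriction W K') := by
  -- Mordell–Weil over the number field `K̃′`
  haveI : (W.baseChange (galoisClosureIn (K := ℚ) K')).IsElliptic := by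
    rw [WeierstrassCurve.baseChange]; infer_instance
  have hfg := (W.baseChange (galoisClosureIn (K := ℚ) K')).addGroup_fg_point_holds
  haveI : AddGroup.FG (W.baseChange (galoisClosureIn (K := ℚ) K')).toAffine.Point := by convert hfg
  haveI : Module.Finite ℤ (W.baseChange (galoisClosureIn (K := ℚ) K')).toAffine.Point :=
    Module.Finite.iff_addGroup_fg.mpr inferInstance
  exact shaRestriction_injective_sylvester hp hp2 W hW K' hL
    (exists_nsmul_mem_baseChange_of_mordellWeilRank_eq W _ hrank)

end Summit.BirchSwinnertonDyer.BirchSwinnertonDyer.Theorems.SylvesterTwoUpper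

end
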